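import Summits.QuantumFields.BalabanUV.InfraRed.StrongCouplingFrozenForestKR

/-!
# Strong coupling, forest gauge — rung F3 PROVED: frozen-forest clustering (part 3 of 3)

**observatory of the non-perturbative crossover; no mass-gap claim.**  Cell `pub-balaban`, build IR-3 v2
(two-front crossover ledger), IR-SC lineage; companion of `StrongCouplingForestGaugeFixing` (the frozen Wilson
measure `frozenWilsonMeasure ρ F β`, rung F2 typed as `ForestGaugeFixing`), `StrongCouplingForestDoorAssembly` (rung F3
typed as `FrozenForestClustering`; F2 + F3 ⇒ `ForestDobrushinDoor`) and `StrongCouplingForestGauge` (forest rows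
`forestRow F e`, `ForestRowBound F D`, the door `ForestDobrushinDoor`).

WHAT THIS FILE PROVES (kernel-checked; every analytic input is a HYPOTHESIS of the statements, exactly as in the tree's
`StrongCouplingTorusWindow`).  `theorem frozenForestClustering : FrozenForestClustering` — the obligation node F3
of `StrongCouplingForestDoorAssembly` is a THEOREM: for `SU(N)`, `d = 4`, frozen link sets `Fs S` with
`ForestRowBound (Fs S) D` on the tori `(ℤ/(2S+1))⁴`, `(|β|/N)·6 ≤ R`, `OneLinkKRModulus N R K` and `D (|β|/N) K ≤ c < 1`,
ONE constant bounds the connected correlations of bounded measurable local observables under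
`frozenWilsonMeasure (fundamentalRep (Fin N)) (Fs S) β` by `C e^{−krRate c ‖x‖_∞}`, uniformly in `S`.  Hence the forest
door is conditional on F2 ALONE, by name: `forestDobrushinDoor_of_gaugeFixing : ForestGaugeFixing (SU(2)) →
ForestDobrushinDoor`.

THE MECHANISM.  The frozen Wilson measure `μ_β^F = Z_F⁻¹ e^{−β S_W} d(⊗_{e ∉ F} Haar ⊗ ⊗_{e ∈ F} δ₁)` is a GIBBS MEASURE
of an explicit finite-range specification on the FULL link set of the torus — no re-indexing by the dynamic links —,
namely the Gibbsian specification with SITE-DEPENDENT a priori measures `ν_e = δ₁` (`e ∈ F`), `ν_e = Haar` (`e ∉ F`)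
and the volume-independent bounded energy `U ↦ ∑_q log v((freeze_F U)_q)` of the configuration FROZEN on `F` (the
tree's `isSpecification_tilted_map_glueWith_pi_hetero`; Friedli–Velenik §6.10.1, Georgii Def. 2.9); §1–§3 are the
imported part 1 `StrongCouplingFrozenForestSpec`, §4–§6 the imported part 2 `StrongCouplingFrozenForestKR`:
* §1–§2 `freezeConfig`, `frozenRef`, `frozenSpec`, `isSpecification_frozenSpec`, `frozenSpec_univ`; freezing is the
  identity `frozenHaar F`-a.e. (`freezeConfig_ae_eq`), so the energy may be frozen inside the tilt
  (`frozenHaar_tilted_freeze`);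
* §3 the one-link laws: `δ₁` at a frozen link whatever the boundary condition (`siteLaw_frozenSpec_of_mem`), the torus
  one-link law at the FROZEN boundary condition at a dynamic link (`siteLaw_frozenSpec_of_not_mem`);
* §4 `frozenWilsonMeasure_eq_tilted`, `isGibbsMeasure_frozenWilsonMeasure` — the DLR equations of `μ_β^F`;
* §5 `isKRContraction_frozenWilson` — Dobrushin's condition in Föllmer's Kantorovich–Rubinstein form (Ch. I (2.20))
  for the frozen specification with coefficients `C(e,y) = K (|β|/N) n(e,y)` between dynamic links and `0` as soon as
  `e` or `y` is frozen (the torus contraction `isKRContraction_torusWilson` read at frozen boundary conditions); the row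
  sums are EXACTLY `K (|β|/N) · forestRow F e` (`sum_linkNbrT_frozenCoeff_eq`), `≤ D (|β|/N) K` under `ForestRowBound F D`
  (`sum_linkNbrT_frozenCoeff_le`) — the forest-reduced Dobrushin constant;
* §6 DLR smoothing by the frozen specification: locality (`dependsOn_specAvg_frozenSpec`) and the one-link Lipschitz
  bound (`isLipBound_specAvg_frozenSpec`, Georgii Prop. 8.8 in metric form, same constant as on the torus: a frozen
  outside link does not move the energy at all);
* §7 `abs_integral_mul_sub_le_frozenWilson` — Föllmer's covariance estimate (`abs_covariance_le_of_isKRContraction`,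
  generic in the specification) under `μ_β^F`;
* §8 `frozenForestClustering` — the volume-uniform clustering, verbatim the torus argument
  `wilson_torusClustering_of_oneLinkKRModulus` with §7 as its covariance input; `forestDobrushinDoor_of_gaugeFixing`.

Nothing here moves any number of the ledger: the one-link modulus (`OneLinkKRModulus`, for `SU(2)` the quarter
modulus `QuarterModulusUpTo κ` of `StrongCouplingStaggerForest`) remains an off-kernel interval certificate and a
HYPOTHESIS, and the forests enter only through `ForestRowBound`.  No statement of the manuscripts under audit is used.

References (for the specification framework and the covariance estimate only): [cite: Follmer1988, Ch. I (2.20)]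
[cite: Follmer1988, Ch. I Theorem (2.13)] [cite: Georgii2011, Def. 2.9] [cite: Georgii2011, Prop. 8.8]
[cite: FriedliVelenik2017, §6.10.1 eq. (6.110) with Lemma 6.15] [cite: Creutz2022, Ch. 9, eq. (9.19), p. 44].
-/

noncomputable section

open MeasureTheory ProbabilityTheory Filter Function Finset
open Literature.Probability.LatticeModels
open Literature.Probability.LatticeModels.DobrushinMetric
open Literature.MathematicalPhysics.QuantumFieldTheory
open Literature.MathematicalPhysics.QuantumLattice (groupHeatKernelWeight fundamentalRep fundamentalRep_apply fundamentalLatticeRep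
  toTorusObservable LGConfig IsLocalObservable torusEdge torusLift)
open Literature.MathematicalPhysics.QuantumFieldTheory.Balaban1983to89
open Literature.MathematicalPhysics.QuantumFieldTheory.Balaban1983to89.StrongCouplingDobrushinWindow
open Literature.MathematicalPhysics.QuantumFieldTheory.Balaban1983to89.StrongCouplingTorusWindow
open Summit.QuantumFields.BalabanUV.InfraRed.StrongCouplingForestGauge
open Summit.QuantumFields.BalabanUV.InfraRed.StrongCouplingForestGaugeFixing
open Summit.QuantumFields.BalabanUV.InfraRed.StrongCouplingFrozenForestSpec
open Summit.QuantumFields.BalabanUV.InfraRed.StrongCouplingFrozenForestKR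

namespace Summit.QuantumFields.BalabanUV.InfraRed.StrongCouplingFrozenForestClustering

/-! ### §7 `SU(N)`: covariance decay under the frozen Wilson measure in the Kantorovich–Rubinstein regime -/

section FrozenCovariance

variable {d L N : ℕ} [NeZero L]

/-- **Covariance bound under the frozen Wilson measure by DLR smoothing** (Föllmer 1988 Ch. I Thm. (2.13) with
Remark (2.17) on the FROZEN specification; verbatim the torus argument `abs_integral_mul_sub_le_torusWilson` with the
forest-reduced Dobrushin constant `D (|β|/N) K ≤ c ≤ 1` under `ForestRowBound F D`).
[cite: Follmer1988, Ch. I Theorem (2.13)] [cite: Georgii2011, Thm. 8.7, Thm. 8.20, Remark 8.26, §8.2] -/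
theorem abs_integral_mul_sub_le_frozenWilson (hd : 2 ≤ d) (hN : 1 ≤ N) (hL : 1 < L) (F : Finset (Edge d L))
    {Dr : ℕ} (hFD : ForestRowBound F Dr) {β R K c : ℝ} (hK : 0 ≤ K)
    (hR : |β| / N * (2 * ((d : ℝ) - 1)) ≤ R) (hmod : OneLinkKRModulus N R K)
    (hc : (Dr : ℝ) * (|β| / N) * K ≤ c) (hc1 : c ≤ 1)
    {f g : GaugeConfig d L (Matrix.specialUnitaryGroup (Fin N) ℂ) → ℝ} (hfm : Measurable f)
    {Δf : Finset (Edge d L)} (hfdep : DependsOn f (↑Δf : Set (Edge d L))) {Mf : ℝ} (hMf : ∀ σ, |f σ| ≤ Mf)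
    (hgm : Measurable g) {Δg : Finset (Edge d L)} (hgdep : DependsOn g (↑Δg : Set (Edge d L))) {Mg : ℝ}
    (hMg : ∀ σ, |g σ| ≤ Mg) (hsep : ∀ y ∈ plaqClosure Δf, y ∉ Δg) (ℓ : Edge d L → ℕ)
    (hℓ0 : ∀ y ∈ plaqClosure Δg, ℓ y = 0) (hℓ : ∀ x ∉ plaqClosure Δg, ∀ y ∈ linkNbrT x, ℓ x ≤ ℓ y + 1) :
    |(∫ σ, f σ * g σ ∂(frozenWilsonMeasure (d := d) (L := L) (fundamentalRep (Fin N)) F β)) -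
        (∫ σ, f σ ∂(frozenWilsonMeasure (d := d) (L := L) (fundamentalRep (Fin N)) F β)) *
          ∫ σ, g σ ∂(frozenWilsonMeasure (d := d) (L := L) (fundamentalRep (Fin N)) F β)| ≤
      2 * (2 * Real.sqrt N) ^ 2 * (∑ _y ∈ plaqClosure Δg, Mg * wilsonSmoothLip N d β) *
        ∑ y ∈ plaqClosure Δf, c ^ ℓ y * (Mf * wilsonSmoothLip N d β) := by
  classical
  set μ := frozenWilsonMeasure (d := d) (L := L) (fundamentalRep (Fin N)) F β with hμdef
  have hv := continuous_wilsonPlaqWeight (N := N) β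
  have hv0 := wilsonPlaqWeight_pos (N := N) β
  have hγ := isSpecification_frozenSpec (d := d) (L := L) F hv hv0
  have hG : IsGibbsMeasure (frozenSpec (d := d) (L := L) F (wilsonPlaqWeight N β)) μ :=
    isGibbsMeasure_frozenWilsonMeasure F β
  haveI : IsProbabilityMeasure μ := hG.isProbabilityMeasure
  have hd1 : 1 ≤ d := by omega
  have hN0 : (0 : ℝ) < N := by exact_mod_cast (show 0 < N by omega)
  have hKR := isKRContraction_frozenWilson (L := L) hd1 hN hL F hK hR hmod
  have hc0 : 0 ≤ c := le_trans (by positivity) hc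
  have hrow : ∀ e : Edge d L, (∑ y ∈ linkNbrT e,
      if e ∈ F ∨ y ∈ F then (0 : ℝ) else K * (|β| / N) * (tInfluence e y : ℝ)) ≤ c := fun e =>
    (sum_linkNbrT_frozenCoeff_le F hFD hK e).trans hc
  -- the smoothed observables
  set fb := specAvg (frozenSpec (d := d) (L := L) F (wilsonPlaqWeight N β)) Δf f with hfb
  set gb := specAvg (frozenSpec (d := d) (L := L) F (wilsonPlaqWeight N β)) Δg g with hgb
  have hfbm : Measurable fb := measurable_specAvg hγ Δf hfm
  have hgbm : Measurable gb := measurable_specAvg hγ Δg hgm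
  have hfbM : ∀ σ, |fb σ| ≤ Mf := abs_specAvg_le hγ Δf hMf
  have hgbM : ∀ σ, |gb σ| ≤ Mg := abs_specAvg_le hγ Δg hMg
  have hfbdep : DependsOn fb (↑(plaqClosure Δf) : Set (Edge d L)) :=
    dependsOn_specAvg_frozenSpec F hv Δf hfm hfdep
  have hgbdep : DependsOn gb (↑(plaqClosure Δg) : Set (Edge d L)) :=
    dependsOn_specAvg_frozenSpec F hv Δg hgm hgdep
  have hvLip : ∀ (q : Plaquette d L) (y : Edge d L), y ∈ plaqEdgesT q →
      ∀ U U' : GaugeConfig d L (Matrix.specialUnitaryGroup (Fin N) ℂ), (∀ z, z ≠ y → U z = U' z) →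
      |Real.log (wilsonPlaqWeight N β (plaquetteHolonomy U q.1 q.2.1.1 q.2.1.2)) -
          Real.log (wilsonPlaqWeight N β (plaquetteHolonomy U' q.1 q.2.1.1 q.2.1.2))| ≤
        |β| * Real.sqrt N * suFrobDist (U y) (U' y) :=
    fun q y hy U U' hUU' => abs_log_wilsonPlaqWeight_hol_sub_le hL β q hy hUU'
  have hD : (0 : ℝ) < 2 * Real.sqrt N := by positivity
  have hfbLip : IsLipBound suFrobDist fb fun _ => Mf * wilsonSmoothLip N d β :=
    isLipBound_specAvg_frozenSpec F hv hv0 suFrobDist_nonneg hD suFrobDist_le (by positivity) hvLip Δf hfm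
      hfdep hMf
  have hgbLip : IsLipBound suFrobDist gb fun _ => Mg * wilsonSmoothLip N d β :=
    isLipBound_specAvg_frozenSpec F hv hv0 suFrobDist_nonneg hD suFrobDist_le (by positivity) hvLip Δg hgm
      hgdep hMg
  -- DLR identities: smoothing does not change the three integrals
  have h1 : ∫ σ, f σ * g σ ∂μ = ∫ σ, fb σ * gb σ ∂μ := by
    have ha : ∫ η, fb η * g η ∂μ = ∫ σ, f σ * g σ ∂μ :=
      integral_specAvg_mul hγ hG Δf hfm hMf hgm hMg hgdep fun x hx => hsep x (subset_plaqClosure Δf hx)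
    have hb : ∫ η, gb η * fb η ∂μ = ∫ σ, g σ * fb σ ∂μ :=
      integral_specAvg_mul hγ hG Δg hgm hMg hfbm hfbM hfbdep fun x hx hx' => hsep x hx' hx
    rw [← ha]
    have hb' : ∫ η, fb η * gb η ∂μ = ∫ σ, fb σ * g σ ∂μ := by
      simp_rw [mul_comm (fb _)]
      exact hb
    exact hb'.symm
  have h2 : ∫ σ, f σ ∂μ = ∫ σ, fb σ ∂μ := (integral_specAvg hγ hG Δf hfm hMf).symm
  have h3 : ∫ σ, g σ ∂μ = ∫ σ, gb σ ∂μ := (integral_specAvg hγ hG Δg hgm hMg).symm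
  rw [h1, h2, h3]
  have key := abs_covariance_le_of_isKRContraction hγ hKR (r := suFrobDist) (R := 2 * Real.sqrt N)
    suFrobDist_nonneg suFrobDist_le hD.le hc0 hc1 hrow hG hfbm hfbdep hfbM hfbLip hgbm hgbdep hgbM hgbLip ℓ hℓ0 hℓ
  have hcov : cov[fb, gb; μ] = (∫ σ, fb σ * gb σ ∂μ) - (∫ σ, fb σ ∂μ) * ∫ σ, gb σ ∂μ := by
    rw [covariance_eq_sub]
    · rfl
    · exact memLp_of_bounded (a := -Mf) (b := Mf) (ae_of_all _ fun σ => abs_le.1 (hfbM σ))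
        hfbm.aestronglyMeasurable 2
    · exact memLp_of_bounded (a := -Mg) (b := Mg) (ae_of_all _ fun σ => abs_le.1 (hgbM σ))
        hgbm.aestronglyMeasurable 2
  rw [hcov] at key
  exact key

end FrozenCovariance

/-! ### §8 Rung F3: frozen-forest clustering, PROVED -/

section Clustering

open Summit.QuantumFields.BalabanUV.InfraRed.StrongCouplingForestDoorAssembly

/-- **RUNG F3 — FROZEN-FOREST CLUSTERING, kernel-proved** (`SU(N)`, `d = 4`): Föllmer's covariance estimate for the
frozen specification, whose Dobrushin row at a dynamic link `e` is `(|β|/N) K · forestRow (Fs S) e ≤ D (|β|/N) K ≤ c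
< 1`, gives ONE constant `C` bounding the connected correlation of bounded measurable local observables `F₁`,
`F₂ ∘ θ_x` under `frozenWilsonMeasure (fundamentalRep (Fin N)) (Fs S) β` by `C e^{−krRate c ‖x‖_∞}` on every torus
`(ℤ/(2S+1))⁴`, `S ≥ S₀`, `S ≥ 1`, `2‖x‖_∞ < 2S+1` — verbatim the torus argument
`wilson_torusClustering_of_oneLinkKRModulus` with `abs_integral_mul_sub_le_frozenWilson` as its covariance input.
The one-link modulus `OneLinkKRModulus N R K` and the forests stay HYPOTHESES of the statement.
[cite: Follmer1988, Ch. I Theorem (2.13)] [cite: Georgii2011, Thm. 8.7, Thm. 8.20, Remark 8.26, §8.2]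
[cite: Creutz2022, Ch. 9, eq. (9.19), p. 44] -/
theorem frozenForestClustering : FrozenForestClustering := by
  intro N Dr hN Fs S₀ hFs β R K c hK hR hmod hc hc1 F₁ F₂ h₁ h₂ h₁m h₂m hb₁ hb₂
  classical
  obtain ⟨Λ₁, hΛ₁⟩ := h₁
  obtain ⟨Λ₂, hΛ₂⟩ := h₂
  obtain ⟨M₁, hM₁⟩ := hb₁
  obtain ⟨M₂, hM₂⟩ := hb₂
  -- the Dobrushin constant actually used and the mass
  set c' : ℝ := max c (1 / 2) with hc'def
  have hc'0 : 0 < c' := lt_max_of_lt_right (by norm_num)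
  have hc'1 : c' < 1 := max_lt hc1 (by norm_num)
  have hcc' : c ≤ c' := le_max_left _ _
  have hlogc : Real.log c' < 0 := Real.log_neg hc'0 hc'1
  have hM₁0 : 0 ≤ M₁ := (abs_nonneg _).trans (hM₁ fun _ => 1)
  have hM₂0 : 0 ≤ M₂ := (abs_nonneg _).trans (hM₂ fun _ => 1)
  have hN0 : (0 : ℝ) < N := by exact_mod_cast (show 0 < N by omega)
  have hE0 : 0 ≤ wilsonSmoothLip N 4 β := wilsonSmoothLip_nonneg hN 4 β
  have hR' : |β| / N * (2 * (((4 : ℕ) : ℝ) - 1)) ≤ R := by norm_num; linarith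
  -- the diameter of the two supports and the constant
  set D : ℕ := (Λ₁ ×ˢ Λ₂).sup fun ab => Literature.Probability.LatticeModels.Site.supNorm (ab.1.1 - ab.2.1)
    with hDdef
  set K' : ℝ := Real.exp (-(((D + 2 : ℕ) : ℝ) * Real.log c')) with hK'def
  have hK'0 : 0 < K' := Real.exp_pos _
  set J : ℝ := ((1 + 4 * (2 * (4 - 1)) : ℕ) : ℝ) with hJdef
  have hJ0 : 0 ≤ J := by rw [hJdef]; exact Nat.cast_nonneg _
  set E : ℝ := wilsonSmoothLip N 4 β
  refine ⟨2 * M₁ * M₂ * K' + 2 * (2 * Real.sqrt N) ^ 2 * ((Λ₂.card * J) * (M₂ * E)) *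
    ((Λ₁.card * J) * (K' * (M₁ * E))), fun S hS₀ hS1 x hx => ?_⟩
  set L : ℕ := 2 * S + 1 with hLdef
  have hL1 : 1 < L := by omega
  set μ := frozenWilsonMeasure (d := 4) (L := L) (fundamentalRep (Fin N)) (Fs S) β with hμdef
  haveI : IsProbabilityMeasure μ := (isGibbsMeasure_frozenWilsonMeasure (d := 4) (L := L) (Fs S) β).isProbabilityMeasure
  -- the observables on the torus of side `L`
  set f : GaugeConfig 4 L (Matrix.specialUnitaryGroup (Fin N) ℂ) → ℝ := toTorusObservable L F₁
  set g : GaugeConfig 4 L (Matrix.specialUnitaryGroup (Fin N) ℂ) → ℝ :=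
    toTorusObservable L (F₂ ∘ Literature.MathematicalPhysics.QuantumLattice.configShift x)
  have hfm : Measurable f := h₁m.comp (measurable_torusLift L)
  have hgm : Measurable g := (h₂m.comp (Literature.MathematicalPhysics.QuantumLattice.configShift x).measurable).comp (measurable_torusLift L)
  have hfdep := dependsOn_toTorusObservable (G := Matrix.specialUnitaryGroup (Fin N) ℂ) L hΛ₁
  have hgdep := dependsOn_toTorusObservable_configShift (G := Matrix.specialUnitaryGroup (Fin N) ℂ) L hΛ₂ x
  have hMf : ∀ σ, |f σ| ≤ M₁ := fun σ => hM₁ _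
  have hMg : ∀ σ, |g σ| ≤ M₂ := fun σ => hM₂ _
  rw [show (∫ V, toTorusObservable L (fun U => F₁ U * F₂ (Literature.MathematicalPhysics.QuantumLattice.configShift x U)) V ∂μ) = ∫ V, f V * g V ∂μ from rfl]
  set Δf : Finset (Edge 4 L) := Λ₁.image (torusEdge L)
  set Δg : Finset (Edge 4 L) := Λ₂.image fun e => torusEdge L (e.1 - x, e.2) with hΔg
  have hfdep' : DependsOn f (↑Δf : Set (Edge 4 L)) := hfdep
  have hgdep' : DependsOn g (↑Δg : Set (Edge 4 L)) := hgdep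
  have hxL : 2 * Literature.Probability.LatticeModels.Site.supNorm x < L := by
    rw [Literature.Probability.LatticeModels.Site.norm_eq_supNorm] at hx
    exact_mod_cast hx
  have hexp : Real.exp (-(krRate c * ‖x‖)) =
      Real.exp ((Literature.Probability.LatticeModels.Site.supNorm x : ℝ) * Real.log c') := by
    rw [Literature.Probability.LatticeModels.Site.norm_eq_supNorm, krRate, ← hc'def]
    congr 1
    ring
  rw [hexp]
  -- the trivial bound `|cov| ≤ 2 M₁ M₂`
  have htriv : |(∫ V, f V * g V ∂μ) - (∫ V, f V ∂μ) * ∫ V, g V ∂μ| ≤ 2 * M₁ * M₂ := by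
    calc |(∫ V, f V * g V ∂μ) - (∫ V, f V ∂μ) * ∫ V, g V ∂μ|
        ≤ |∫ V, f V * g V ∂μ| + |(∫ V, f V ∂μ) * ∫ V, g V ∂μ| := abs_sub _ _
      _ ≤ M₁ * M₂ + M₁ * M₂ := by
          refine add_le_add (abs_integral_le_of_abs_le (abs_mul_le_of_abs_le hMf hMg)) ?_
          rw [abs_mul]
          exact mul_le_mul (abs_integral_le_of_abs_le hMf) (abs_integral_le_of_abs_le hMg) (abs_nonneg _) hM₁0
      _ = 2 * M₁ * M₂ := by ring
  by_cases hnear : Literature.Probability.LatticeModels.Site.supNorm x < D + 2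
  · -- NEAR: `K' e^{‖x‖ log c'} ≥ 1`
    have hone : 1 ≤ K' * Real.exp ((Literature.Probability.LatticeModels.Site.supNorm x : ℝ) * Real.log c') := by
      rw [hK'def, ← Real.exp_add]
      refine Real.one_le_exp ?_
      have : ((Literature.Probability.LatticeModels.Site.supNorm x : ℕ) : ℝ) ≤ ((D + 2 : ℕ) : ℝ) := by
        exact_mod_cast hnear.le
      nlinarith
    refine htriv.trans ?_
    calc 2 * M₁ * M₂ ≤ 2 * M₁ * M₂ * (K' * Real.exp
          ((Literature.Probability.LatticeModels.Site.supNorm x : ℝ) * Real.log c')) :=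
          le_mul_of_one_le_right (by positivity) hone
      _ ≤ (2 * M₁ * M₂ * K' + 2 * (2 * Real.sqrt N) ^ 2 * ((Λ₂.card * J) * (M₂ * E)) *
            ((Λ₁.card * J) * (K' * (M₁ * E)))) *
            Real.exp ((Literature.Probability.LatticeModels.Site.supNorm x : ℝ) * Real.log c') := by
          rw [add_mul]
          refine le_add_of_le_of_nonneg (le_of_eq (by ring)) (by positivity)
  -- FAR: `D + 2 ≤ ‖x‖_∞`; the plaquette closure of `Δf` misses `Δg`
  rw [not_lt] at hnear
  have hsep : ∀ y ∈ plaqClosure Δf, y ∉ Δg := by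
    intro y hy hyg
    obtain ⟨y₀, hy₀, hyy₀⟩ := exists_near_of_mem_plaqClosure hy
    obtain ⟨a, ha, rfl⟩ := Finset.mem_image.1 hy₀
    obtain ⟨b, hb, rfl⟩ := Finset.mem_image.1 hyg
    have hs := supNorm_le_torusNorm_add (L := L) (a := a.1) (b := b.1) hxL
    have hDab : Literature.Probability.LatticeModels.Site.supNorm (a.1 - b.1) ≤ D := by
      rw [hDdef]
      exact Finset.le_sup (f := fun ab : ZdEdge 4 × ZdEdge 4 =>
        Literature.Probability.LatticeModels.Site.supNorm (ab.1.1 - ab.2.1)) (Finset.mk_mem_product ha hb)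
    have h1 : torusNorm ((torusEdge L a).1 - (torusEdge L (b.1 - x, b.2)).1) ≤ 1 := by
      rw [← torusNorm_neg, neg_sub]; exact hyy₀
    have h2 : Literature.Probability.LatticeModels.Site.supNorm x ≤ 1 + D := hs.trans (Nat.add_le_add h1 hDab)
    omega
  by_cases hΛ₂e : Λ₂ = ∅
  · -- `F₂` is constant on the torus: the covariance vanishes
    have hΔg0 : Δg = ∅ := by rw [hΔg, hΛ₂e, Finset.image_empty]
    set V₁ : GaugeConfig 4 L (Matrix.specialUnitaryGroup (Fin N) ℂ) := fun _ => 1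
    have hgc : ∀ V, g V = g V₁ := fun V => hgdep' fun i hi => by simp [hΔg0] at hi
    have hI1 : ∫ V, f V * g V ∂μ = (∫ V, f V ∂μ) * g V₁ := by
      rw [← integral_mul_const]
      exact integral_congr_ae (ae_of_all _ fun V => by simp only [hgc V])
    have hI2 : ∫ V, g V ∂μ = g V₁ := by
      have h := integral_congr_ae (μ := μ) (ae_of_all μ fun V => hgc V)
      rw [integral_const, smul_eq_mul, probReal_univ, one_mul] at h
      exact h
    have hI : (∫ V, f V * g V ∂μ) - (∫ V, f V ∂μ) * ∫ V, g V ∂μ = 0 := by rw [hI1, hI2, sub_self]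
    rw [hI, abs_zero]
    positivity
  -- the distance profile to `plaqClosure Δg`
  have hΔgne : (plaqClosure Δg).Nonempty :=
    ((Finset.nonempty_iff_ne_empty.2 hΛ₂e).image _).mono (subset_plaqClosure Δg)
  obtain ⟨ℓ, hℓ0, hℓ1, hℓ2⟩ := exists_linkProfile (plaqClosure Δg) hΔgne
  have hc'' : (Dr : ℝ) * (|β| / N) * K ≤ c' := hc.trans hcc'
  have key := abs_integral_mul_sub_le_frozenWilson (d := 4) (by norm_num) hN hL1 (Fs S) (hFs S hS₀) hK hR' hmod
    hc'' hc'1.le hfm hfdep' hMf hgm hgdep' hMg hsep ℓ hℓ0 (fun x' _ y hy => hℓ1 x' y hy)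
  refine key.trans ?_
  -- `c' ^ ℓ y ≤ K' e^{‖x‖ log c'}` on `plaqClosure Δf`
  have hpow : ∀ y ∈ plaqClosure Δf, c' ^ ℓ y ≤
      K' * Real.exp ((Literature.Probability.LatticeModels.Site.supNorm x : ℝ) * Real.log c') := by
    intro y hy
    obtain ⟨y₀, hy₀, hyy₀⟩ := exists_near_of_mem_plaqClosure hy
    obtain ⟨a, ha, rfl⟩ := Finset.mem_image.1 hy₀
    obtain ⟨z, hz, hzle⟩ := hℓ2 y
    obtain ⟨z₀, hz₀, hzz₀⟩ := exists_near_of_mem_plaqClosure hz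
    obtain ⟨b, hb, rfl⟩ := Finset.mem_image.1 hz₀
    have hs := supNorm_le_torusNorm_add (L := L) (a := a.1) (b := b.1) hxL
    have hDab : Literature.Probability.LatticeModels.Site.supNorm (a.1 - b.1) ≤ D := by
      rw [hDdef]
      exact Finset.le_sup (f := fun ab : ZdEdge 4 × ZdEdge 4 =>
        Literature.Probability.LatticeModels.Site.supNorm (ab.1.1 - ab.2.1)) (Finset.mk_mem_product ha hb)
    have htri : torusNorm ((torusEdge L a).1 - (torusEdge L (b.1 - x, b.2)).1) ≤ 1 + ℓ y + 1 := by
      calc torusNorm ((torusEdge L a).1 - (torusEdge L (b.1 - x, b.2)).1)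
          ≤ torusNorm ((torusEdge L a).1 - y.1) + torusNorm (y.1 - (torusEdge L (b.1 - x, b.2)).1) :=
            torusNorm_sub_le _ _ _
        _ ≤ torusNorm ((torusEdge L a).1 - y.1) +
              (torusNorm (y.1 - z.1) + torusNorm (z.1 - (torusEdge L (b.1 - x, b.2)).1)) :=
            Nat.add_le_add_left (torusNorm_sub_le _ _ _) _
        _ ≤ 1 + (ℓ y + 1) := by
            refine Nat.add_le_add ?_ (Nat.add_le_add hzle hzz₀)
            rw [← torusNorm_neg, neg_sub]; exact hyy₀
        _ = 1 + ℓ y + 1 := by ring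
    have hineq : (Literature.Probability.LatticeModels.Site.supNorm x : ℝ) ≤ ℓ y + ((D + 2 : ℕ) : ℝ) := by
      have : Literature.Probability.LatticeModels.Site.supNorm x ≤ ℓ y + (D + 2) := by
        have := hs.trans (Nat.add_le_add htri hDab); omega
      exact_mod_cast this
    rw [hK'def, ← Real.exp_add, ← Real.exp_log hc'0, ← Real.exp_nat_mul, Real.exp_log hc'0]
    refine Real.exp_le_exp.2 ?_
    nlinarith
  have hsumf : ∑ y ∈ plaqClosure Δf, c' ^ ℓ y * (M₁ * E) ≤
      (Λ₁.card * J) * (K' * Real.exp ((Literature.Probability.LatticeModels.Site.supNorm x : ℝ) * Real.log c') *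
        (M₁ * E)) := by
    calc ∑ y ∈ plaqClosure Δf, c' ^ ℓ y * (M₁ * E)
        ≤ ∑ _y ∈ plaqClosure Δf, K' * Real.exp ((Literature.Probability.LatticeModels.Site.supNorm x : ℝ) *
            Real.log c') * (M₁ * E) :=
          Finset.sum_le_sum fun y hy => mul_le_mul_of_nonneg_right (hpow y hy) (by positivity)
      _ = (plaqClosure Δf).card * (K' * Real.exp ((Literature.Probability.LatticeModels.Site.supNorm x : ℝ) *
            Real.log c') * (M₁ * E)) := by rw [Finset.sum_const, nsmul_eq_mul]
      _ ≤ (Λ₁.card * J) * (K' * Real.exp ((Literature.Probability.LatticeModels.Site.supNorm x : ℝ) *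
            Real.log c') * (M₁ * E)) := by
          refine mul_le_mul_of_nonneg_right ?_ (by positivity)
          have h1 : ((plaqClosure Δf).card : ℝ) ≤ Δf.card * J := by
            rw [hJdef]; exact_mod_cast card_plaqClosure_le Δf
          have h2 : (Δf.card : ℝ) ≤ Λ₁.card := by exact_mod_cast Finset.card_image_le
          exact h1.trans (mul_le_mul_of_nonneg_right h2 hJ0)
  have hsumg : ∑ _y ∈ plaqClosure Δg, M₂ * E ≤ (Λ₂.card * J) * (M₂ * E) := by
    rw [Finset.sum_const, nsmul_eq_mul]
    refine mul_le_mul_of_nonneg_right ?_ (by positivity)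
    have h1 : ((plaqClosure Δg).card : ℝ) ≤ Δg.card * J := by
      rw [hJdef]; exact_mod_cast card_plaqClosure_le Δg
    have h2 : (Δg.card : ℝ) ≤ Λ₂.card := by exact_mod_cast Finset.card_image_le
    exact h1.trans (mul_le_mul_of_nonneg_right h2 hJ0)
  have hsumg0 : 0 ≤ ∑ _y ∈ plaqClosure Δg, M₂ * E := Finset.sum_nonneg fun _ _ => by positivity
  calc 2 * (2 * Real.sqrt N) ^ 2 * (∑ _y ∈ plaqClosure Δg, M₂ * E) * ∑ y ∈ plaqClosure Δf, c' ^ ℓ y * (M₁ * E)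
      ≤ 2 * (2 * Real.sqrt N) ^ 2 * ((Λ₂.card * J) * (M₂ * E)) * ((Λ₁.card * J) * (K' * Real.exp
          ((Literature.Probability.LatticeModels.Site.supNorm x : ℝ) * Real.log c') * (M₁ * E))) := by
        exact mul_le_mul (mul_le_mul_of_nonneg_left hsumg (by positivity)) hsumf
          (Finset.sum_nonneg fun _ _ => by positivity) (by positivity)
    _ = 2 * (2 * Real.sqrt N) ^ 2 * ((Λ₂.card * J) * (M₂ * E)) * ((Λ₁.card * J) * (K' * (M₁ * E))) *
          Real.exp ((Literature.Probability.LatticeModels.Site.supNorm x : ℝ) * Real.log c') := by ring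
    _ ≤ (2 * M₁ * M₂ * K' + 2 * (2 * Real.sqrt N) ^ 2 * ((Λ₂.card * J) * (M₂ * E)) *
          ((Λ₁.card * J) * (K' * (M₁ * E)))) *
          Real.exp ((Literature.Probability.LatticeModels.Site.supNorm x : ℝ) * Real.log c') := by
        rw [add_mul]
        exact le_add_of_nonneg_left (by positivity)

/-- **The forest door from F2 alone** (`SU(2)`, Wilson units): with F3 proved, `ForestGaugeFixing (fundamentalRep (Fin 2))`
gives `ForestDobrushinDoor` of `StrongCouplingForestGauge`. [cite: Creutz2022, Ch. 9, eq. (9.19), p. 44]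
[cite: Follmer1988, Ch. I Theorem (2.13)] -/
theorem forestDobrushinDoor_of_gaugeFixing
    (hF2 : ForestGaugeFixing (G := Matrix.specialUnitaryGroup (Fin 2) ℂ) (fundamentalRep (Fin 2))) :
    ForestDobrushinDoor :=
  forestDobrushinDoor_of_gaugeFixing_of_frozenClustering hF2 frozenForestClustering

end Clustering

end Summit.QuantumFields.BalabanUV.InfraRed.StrongCouplingFrozenForestClustering
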